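import Summits.ResolutionOfSingularities.ResolutionOfSingularities.Theorems.UniformComplexityCampaignW82SpecializationNormalForms
import Summits.ResolutionOfSingularities.ResolutionOfSingularities.Theorems.UniformComplexityPrimeModelTransferSpecialization
import Summits.ResolutionOfSingularities.ResolutionOfSingularities.Theorems.UniformComplexityPrimeModelTransferAlgClosedTower
import Mathlib.FieldTheory.IsAlgClosed.AlgebraicClosure
import Mathlib.FieldTheory.IntermediateField.Adjoin.Algebra
import Mathlib.RingTheory.AlgebraicIndependent.TranscendenceBasis
import Mathlib.RingTheory.AlgebraicIndependent.Basic
import Mathlib.RingTheory.MvPolynomial.Basic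
import Mathlib.Algebra.CharP.Algebra
import Mathlib.Algebra.Algebra.ZMod
import HarnessLib

/-!
# Crux `PrimeModelTransfer` (stmt-ResolutionOfSingularities-8933), door 2 of slot W8.2:
# the lane-signed `Ω`-TRANSFER normal form, proved by name

Route `ResolutionOfSingularities/UniformComplexity`. The typer's OURS statement
`CampaignW82.OmegaTransfer p` (Theorems/UniformComplexityCampaignW82SpecializationNormalForms.lean,
p481773: for every algebraically closed `Ω` of characteristic `p` of infinite transcendence degree
over its prime subfield, the crux hypothesis `PrimeClosureRes p` gives resolution over `Ω`) is here
shown EQUIVALENT to the crux's `p`-slice `CampaignW82.PrimeModelTransferAt p`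
(`primeModelTransferAt_iff_omegaTransfer`). The direction `PrimeModelTransferAt → OmegaTransfer` is
the typer's pure-logic anchor; the converse uses ONE admissible `Ω`, namely
`Ω₀ = AlgebraicClosure (FractionRing (MvPolynomial ℕ (ZMod p)))` — its variables are algebraically
independent over the prime subfield (`aleph0_le_trdeg_bot_omega0`), and resolution over `Ω₀`
specialises to every algebraically closed field of finite transcendence degree, which embeds into
`Ω₀` (transcendence basis + `IsAlgClosed.lift`; private copies of the two auxiliary lemmas of
`Theorems/UniformComplexityPrimeModelTransferOneField.lean`, p486825, so that this file builds only
on Theses-free modules), whence to every algebraically closed field by descent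
(`PrimeModelTransfer.hasResolution_of_perfectSubfields`). Also by name:
`omegaTransferAt_omega0_iff_primeModelTransferAt` (the single field `Ω₀` suffices).

[OURS · LADDER-RESOLUTION L1, slot W8.2 (prime-field / universality transfer), door 2
UniformComplexity] By-name links; NOT statements of, and attributing nothing to, Hironaka's 2017
manuscript. AI-written; weaker than expert review. Theses-free module.
-/

noncomputable section

set_option linter.dupNamespace false -- mandated namespace of this single-conjunct summit

open CategoryTheory CategoryTheory.Limits AlgebraicGeometry TopologicalSpace
open Literature.AlgebraicGeometry.Resolution
open scoped Cardinal IntermediateField.algebraAdjoinAdjoin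

namespace Summit.ResolutionOfSingularities.ResolutionOfSingularities.Theorems.CampaignW82

/-! ## Private copies of the embedding lemmas (Theses-free content of p486825) -/

/-- **Algebraically closed targets of infinite transcendence degree receive every field of finite
type-up-to-algebraic-extension.** Let `F ⊆ K` be fields, `s ⊆ K` finite, and `A` the algebraic
closure in `K` of `F(s)`. If `Ω ⊇ F` is algebraically closed and contains a sequence
`x : ℕ → Ω` algebraically independent over `F`, then there is a ring map `A → Ω`: choose
a transcendence basis `t ⊆ s` of `F[s]` over `F`, send it injectively into the `xᵢ`
(`F[t] ≅ F[Xᵢ : i ∈ t] ↪ Ω`), and extend to `A`, which is algebraic over `F[t]`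
(`IsAlgClosed.lift`). [folklore] -/
private theorem nonempty_ringHom_algebraicClosure_adjoin' (F : Type) [Field F] (K : Type) [Field K]
    [Algebra F K] (s : Finset K) (Ω : Type) [Field Ω] [Algebra F Ω] [IsAlgClosed Ω] (x : ℕ → Ω)
    (hx : AlgebraicIndependent F x) :
    Nonempty (algebraicClosure (IntermediateField.adjoin F (↑s : Set K)) K →+* Ω) := by
  classical
  -- the domain `D = F[s]`, the field `E = F(s)` and `A = E^{alg} ∩ K`
  let D : Subalgebra F K := Algebra.adjoin F (↑s : Set K)
  let E : IntermediateField F K := IntermediateField.adjoin F (↑s : Set K)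
  let A : IntermediateField E K := algebraicClosure E K
  -- `D` is generated by the (finite) preimage of `s`
  let sD : Set D := Subtype.val ⁻¹' (↑s : Set K)
  have hsD_fin : sD.Finite := (s.finite_toSet.preimage Subtype.val_injective.injOn)
  have hsD : Algebra.adjoin F sD = ⊤ := by
    apply Subalgebra.map_injective (f := D.val) Subtype.val_injective
    rw [AlgHom.map_adjoin, Algebra.map_top, Subalgebra.range_val]
    have himg : (D.val : D → K) '' sD = (↑s : Set K) := by
      ext y
      constructor
      · rintro ⟨z, hz, rfl⟩; exact hz
      · intro hy; exact ⟨⟨y, Algebra.subset_adjoin hy⟩, hy, rfl⟩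
    change Algebra.adjoin F (D.val '' sD) = D
    rw [himg]
  haveI : Algebra.IsAlgebraic (Algebra.adjoin F sD) D :=
    ⟨fun d => by
      have hd : d ∈ Algebra.adjoin F sD := hsD ▸ Algebra.mem_top
      exact isAlgebraic_algebraMap (R := Algebra.adjoin F sD) (A := D) ⟨d, hd⟩⟩
  -- a finite transcendence basis `t ⊆ sD` of `D` over `F`
  obtain ⟨t, hts, ht⟩ := exists_isTranscendenceBasis_subset (R := F) (A := D) sD
  haveI : Finite t := (hsD_fin.subset hts).to_subtype
  obtain ⟨e, he⟩ := Countable.exists_injective_nat t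
  -- the polynomial ring `R₁ = F[T_i : i ∈ t]`, acting on `D` through `t` and on `Ω` through `x ∘ e`
  let R₁ : Type := MvPolynomial t F
  letI : Algebra R₁ D := (MvPolynomial.aeval (Subtype.val : t → D)).toRingHom.toAlgebra
  have hR₁D : Function.Injective (algebraMap R₁ D) :=
    algebraicIndependent_iff_injective_aeval.mp ht.1
  haveI : Algebra.IsAlgebraic R₁ D := by
    haveI := ht.isAlgebraic
    refine Algebra.IsAlgebraic.of_ringHom_of_comp_eq
      (S := Algebra.adjoin F (Set.range (Subtype.val : t → D))) (B := D)
      (ht.1.aevalEquiv : R₁ →ₐ[F] _).toRingHom (RingHom.id D) ht.1.aevalEquiv.surjective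
      Function.injective_id ?_
    exact RingHom.ext fun q => ht.1.algebraMap_aevalEquiv q
  have hx' : AlgebraicIndependent F (x ∘ e) := hx.comp e he
  letI algΩ : Algebra R₁ Ω := (MvPolynomial.aeval (x ∘ e)).toRingHom.toAlgebra
  have hR₁Ω : Function.Injective (algebraMap R₁ Ω) :=
    algebraicIndependent_iff_injective_aeval.mp hx'
  -- `A` is algebraic over `R₁` (through `D ⊆ E ⊆ A`)
  letI : Algebra D A := ((algebraMap E A).comp (algebraMap D E)).toAlgebra
  haveI : IsScalarTower D E A := IsScalarTower.of_algebraMap_eq fun _ => rfl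
  haveI : Algebra.IsAlgebraic E A := algebraicClosure.isAlgebraic E K
  haveI : Algebra.IsAlgebraic D A := Algebra.IsAlgebraic.trans D E A
  have hDA : Function.Injective (algebraMap D A) :=
    (algebraMap E A).injective.comp (FaithfulSMul.algebraMap_injective D E)
  letI : Algebra R₁ A := ((algebraMap D A).comp (algebraMap R₁ D)).toAlgebra
  haveI : IsScalarTower R₁ D A := IsScalarTower.of_algebraMap_eq fun _ => rfl
  haveI : Algebra.IsAlgebraic R₁ A := Algebra.IsAlgebraic.trans R₁ D A
  haveI : FaithfulSMul R₁ A :=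
    (faithfulSMul_iff_algebraMap_injective R₁ A).mpr (hDA.comp hR₁D)
  haveI : FaithfulSMul R₁ Ω := (faithfulSMul_iff_algebraMap_injective R₁ Ω).mpr hR₁Ω
  haveI : Module.IsTorsionFree R₁ A := FaithfulSMul.to_isTorsionFree R₁ A
  haveI : Module.IsTorsionFree R₁ Ω := FaithfulSMul.to_isTorsionFree R₁ Ω
  -- lift
  let ψ : A →ₐ[R₁] Ω := IsAlgClosed.lift
  exact ⟨ψ.toRingHom⟩

/-- `(𝔽_p(x₀, x₁, …))^{alg}` contains an algebraically independent sequence over `𝔽_p` (the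
variables). [folklore] -/
private theorem algebraicIndependent_X_algebraicClosure' (p : ℕ) [Fact p.Prime] :
    AlgebraicIndependent (ZMod p) (fun i : ℕ =>
      algebraMap (MvPolynomial ℕ (ZMod p))
        (AlgebraicClosure (FractionRing (MvPolynomial ℕ (ZMod p)))) (MvPolynomial.X i)) := by
  have h := (MvPolynomial.algebraicIndependent_X ℕ (ZMod p)).map'
    (f := IsScalarTower.toAlgHom (ZMod p) (MvPolynomial ℕ (ZMod p))
      (AlgebraicClosure (FractionRing (MvPolynomial ℕ (ZMod p)))))
    ((algebraMap (FractionRing (MvPolynomial ℕ (ZMod p))) _).injective.comp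
      (IsFractionRing.injective (MvPolynomial ℕ (ZMod p)) (FractionRing (MvPolynomial ℕ (ZMod p)))))
  exact h

/-! ## The countable saturated model `Ω₀(p)` -/

/-- **An algebraically independent sequence over `ZMod p` is algebraically independent over the
prime subfield `⊥`** (the prime subfield of a field of characteristic `p` is the image of
`ZMod p`; transfer of algebraic independence along the surjection `ZMod p → ⊥`). [folklore] -/
theorem algebraicIndependent_bot_of_zmod {p : ℕ} [Fact p.Prime] {Ω : Type} [Field Ω] [CharP Ω p]
    [Algebra (ZMod p) Ω] {ι : Type} {x : ι → Ω} (hx : AlgebraicIndependent (ZMod p) x) :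
    AlgebraicIndependent (⊥ : Subfield Ω) x := by
  -- the surjection `ZMod p → ⊥`
  have hmem : ∀ a : ZMod p, algebraMap (ZMod p) Ω a ∈ (⊥ : Subfield Ω) := fun a => by
    rw [← ZMod.natCast_zmod_val a, map_natCast]
    exact natCast_mem _ _
  let f : ZMod p →+* (⊥ : Subfield Ω) := (algebraMap (ZMod p) Ω).codRestrict _ hmem
  have hf : Function.Surjective f := by
    intro z
    have hz : (z : Ω) ∈ (algebraMap (ZMod p) Ω).fieldRange :=
      bot_le (a := (algebraMap (ZMod p) Ω).fieldRange) z.2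
    obtain ⟨a, ha⟩ := RingHom.mem_fieldRange.mp hz
    exact ⟨a, Subtype.ext ha⟩
  have hcomp : (algebraMap (⊥ : Subfield Ω) Ω).comp f =
      (RingHom.id Ω).comp (algebraMap (ZMod p) Ω) := by
    ext a
    rfl
  have := hx.ringHom_of_comp_eq f (RingHom.id Ω) hf Function.injective_id hcomp
  simpa using this

/-- **`Ω₀(p)` has infinite transcendence degree over its prime subfield**: the variables `xᵢ` form
an algebraically independent sequence (`PrimeModelTransfer.algebraicIndependent_X_algebraicClosure`,
p486825, transferred to the prime subfield). [folklore] -/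
theorem aleph0_le_trdeg_bot_omega0 (p : ℕ) [Fact p.Prime] :
    ℵ₀ ≤ Algebra.trdeg (⊥ : Subfield (AlgebraicClosure (FractionRing (MvPolynomial ℕ (ZMod p)))))
      (AlgebraicClosure (FractionRing (MvPolynomial ℕ (ZMod p)))) := by
  have hx := algebraicIndependent_bot_of_zmod
    (algebraicIndependent_X_algebraicClosure' p)
  have := hx.cardinalMk_le_trdeg
  simpa using this

/-! ## The `Ω`-transfer normal form, by name -/

/-- **Resolution over `Ω₀(p)` gives resolution over every algebraically closed field of
characteristic `p`**: for `K` algebraically closed it suffices to resolve over the algebraically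
closed subfields `(𝔽_p(s))^{alg} ∩ K`, `s` finite
(`PrimeModelTransfer.hasResolution_of_perfectSubfields`),
each of which embeds into `Ω₀(p)` (`PrimeModelTransfer.nonempty_algHom_algebraicClosure_adjoin`),
so the specialization theorem applies
(`PrimeModelTransfer.integralResOver_of_integralResOver_extension`).
[folklore] -/
theorem algClosedRes_of_res_omega0 (p : ℕ) [Fact p.Prime]
    (hΩ : ∀ (X : Scheme.{0})
      (f : X ⟶ Spec (.of (AlgebraicClosure (FractionRing (MvPolynomial ℕ (ZMod p)))))),
      IsSeparated f → LocallyOfFiniteType f → QuasiCompact f → IsIntegral X →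
        Scheme.HasResolution X) :
    AlgClosedRes p := by
  intro K _ _ _ X f hs hl hq hX
  classical
  haveI : PerfectField (AlgebraicClosure (FractionRing (MvPolynomial ℕ (ZMod p)))) :=
    IsAlgClosed.perfectField _
  haveI : PerfectField K := IsAlgClosed.perfectField K
  letI : Algebra (ZMod p) K := ZMod.algebra K p
  refine PrimeModelTransfer.hasResolution_of_perfectSubfields K (fun s => ?_) X f hs hl hq hX
  let E : IntermediateField (ZMod p) K := IntermediateField.adjoin (ZMod p) (↑s : Set K)
  let A : IntermediateField E K := algebraicClosure E K
  haveI : IsAlgClosed A := IsAlgClosure.isAlgClosed E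
  refine ⟨A.toSubfield, fun y hy => ?_, inferInstanceAs (PerfectField A), ?_⟩
  · exact A.algebraMap_mem (⟨y, IntermediateField.subset_adjoin _ _ hy⟩ : E)
  · obtain ⟨ψ⟩ := nonempty_ringHom_algebraicClosure_adjoin' (ZMod p) K s
      (AlgebraicClosure (FractionRing (MvPolynomial ℕ (ZMod p)))) _
      (algebraicIndependent_X_algebraicClosure' p)
    letI : Algebra A (AlgebraicClosure (FractionRing (MvPolynomial ℕ (ZMod p)))) := ψ.toAlgebra
    exact fun Y g hs' hl' hq' hY =>
      PrimeModelTransfer.integralResOver_of_integralResOver_extension A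
        (AlgebraicClosure (FractionRing (MvPolynomial ℕ (ZMod p)))) hΩ Y g hs' hl' hq' hY

/-- **`OmegaTransferAt p Ω₀(p) ⟺ PrimeModelTransferAt p`**: the single countable field `Ω₀(p)`
suffices in the `Ω`-transfer normal form. [folklore] -/
theorem omegaTransferAt_omega0_iff_primeModelTransferAt (p : ℕ) [Fact p.Prime] :
    OmegaTransferAt p (AlgebraicClosure (FractionRing (MvPolynomial ℕ (ZMod p)))) ↔
      PrimeModelTransferAt p :=
  ⟨fun h hA => algClosedRes_of_res_omega0 p (h hA),
    fun h => omegaTransferAt_of_primeModelTransferAt h _⟩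

/-- **`PrimeModelTransferAt p ⟺ OmegaTransfer p`** for prime `p` (by name): the crux's `p`-slice is
EQUIVALENT to the closed saturated-model normal form. (→ is the typer's anchor
`omegaTransfer_of_primeModelTransferAt`; ←: `Ω₀(p)` is admissible, `aleph0_le_trdeg_bot_omega0`,
and `omegaTransferAt_omega0_iff_primeModelTransferAt`.) [folklore] -/
theorem primeModelTransferAt_iff_omegaTransfer {p : ℕ} (hp : p.Prime) :
    PrimeModelTransferAt p ↔ OmegaTransfer p := by
  haveI : Fact p.Prime := ⟨hp⟩
  refine ⟨omegaTransfer_of_primeModelTransferAt, fun h => ?_⟩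
  exact (omegaTransferAt_omega0_iff_primeModelTransferAt p).mp
    (h (AlgebraicClosure (FractionRing (MvPolynomial ℕ (ZMod p)))) (aleph0_le_trdeg_bot_omega0 p))

end Summit.ResolutionOfSingularities.ResolutionOfSingularities.Theorems.CampaignW82

end
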